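import Summits.CriticalPhenomena.CardyFormulaZ2.Theorems.CardyFlipRussoVoronoiHubFromSmirnovInCircleCrossRatio

/-!
# Stub `cocircular_iff_crossRatio_real` of line `moebius-exact-delaunay-dilation-ward`
# (crux `VoronoiHubFromSmirnov`, stmt-CriticalPhenomena-6433)

The classical characterisation behind the "potential defects" of the conformal transport of
Voronoi percolation (quadruples of nuclei that are nearly cocircular, I. Benjamini, O. Schramm,
*Conformal invariance of Voronoi percolation*, Comm. Math. Phys. 197 (1998), §4–§5): four
distinct points `a, b, c, d : ℂ` are COCIRCULAR OR COLLINEAR iff their cross-ratio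
`CR(a,b,c,d) = (a − c)(b − d) / ((a − d)(b − c))` is REAL.

Proof.
* Cocircular `→` real: the landed in-circle test `inCircle_iff_crossRatio_im` (file
  `…InCircleCrossRatio`), clause `dist d o = R ↔ Im CR = 0`.
* Collinear `↔` "all affine coordinates `(p − a)/(b − a)` are real" (`ccr_collinear_iff`), and the
  affine normal form `CR = λ_c (1 − λ_d) / (λ_d (1 − λ_c))` with `λ_p = (p − a)/(b − a)`
  (`ccr_crossRatio_eq`, i.e. invariance of `CR` under `z ↦ (z − a)/(b − a)`): real `λ_c, λ_d` give a
  real `CR`; conversely real `λ_c` and real `CR` force `λ_d = λ_c / (CR (1 − λ_c) + λ_c)` real.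
* Real `→` cocircular when `a, b, c` are NOT collinear: they are affinely independent, hence span a
  `2`-simplex of `ℂ` with a circumcircle (`Affine.Simplex.circumsphere`), and the in-circle test puts
  `d` on it.

No new definitions.
-/

noncomputable section

namespace Summit.CriticalPhenomena.CardyFormulaZ2.Cruxes.VoronoiHubFromSmirnov.MoebiusExactDelaunayDilationWard

/-- A set of points of `ℂ` containing two distinct points `a ≠ b` is (real-)collinear iff every
point `p` of the set has a REAL affine coordinate `(p − a)/(b − a)` in the frame `(a, b)`. -/
theorem ccr_collinear_iff {S : Set ℂ} {a b : ℂ} (ha : a ∈ S) (hb : b ∈ S) (hab : a ≠ b) :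
    Collinear ℝ S ↔ ∀ p ∈ S, ((p - a) / (b - a)).im = 0 := by
  have hba : b - a ≠ 0 := sub_ne_zero.mpr hab.symm
  rw [collinear_iff_of_mem ha]
  constructor
  · rintro ⟨v, hv⟩ p hp
    obtain ⟨rb, hrb⟩ := hv b hb
    obtain ⟨r, hr⟩ := hv p hp
    rw [vadd_eq_add, Complex.real_smul] at hrb hr
    have hb' : b - a = rb * v := by rw [hrb]; ring
    have hp' : p - a = r * v := by rw [hr]; ring
    have hv0 : v ≠ 0 := by
      rintro rfl
      exact hba (by rw [hb', mul_zero])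
    rw [hp', hb', mul_div_mul_right _ _ hv0, ← Complex.ofReal_div, Complex.ofReal_im]
  · intro h
    refine ⟨b - a, fun p hp => ⟨((p - a) / (b - a)).re, ?_⟩⟩
    have key : ((((p - a) / (b - a)).re : ℝ) : ℂ) = (p - a) / (b - a) :=
      Complex.ext (by simp) (by simp [h p hp])
    rw [vadd_eq_add, Complex.real_smul, key, div_mul_cancel₀ _ hba, sub_add_cancel]

/-- Affine normal form of the cross-ratio (its invariance under `z ↦ (z − a)/(b − a)`, which sends
`a, b, c, d` to `0, 1, λ_c, λ_d`): for `a ≠ b`, `a ≠ d`, `b ≠ c`,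
`CR(a,b,c,d) = λ_c (1 − λ_d) / (λ_d (1 − λ_c))` with `λ_p = (p − a)/(b − a)`. -/
theorem ccr_crossRatio_eq {a b c d : ℂ} (hab : a ≠ b) :
    (a - c) * (b - d) / ((a - d) * (b - c)) =
      (c - a) / (b - a) * (1 - (d - a) / (b - a)) /
        ((d - a) / (b - a) * (1 - (c - a) / (b - a))) := by
  have hba : b - a ≠ 0 := sub_ne_zero.mpr hab.symm
  rw [one_sub_div hba, one_sub_div hba, sub_sub_sub_cancel_right, sub_sub_sub_cancel_right,
    div_mul_div_comm, div_mul_div_comm, div_div_div_cancel_right₀ (mul_ne_zero hba hba),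
    ← neg_sub a c, ← neg_sub a d, neg_mul, neg_mul, neg_div_neg_eq]

/-- The algebra of the collinear case: if `q = λ_c (1 − λ_d) / (λ_d (1 − λ_c))` with
`λ_c ∉ {0, 1}`, `λ_d ≠ 0`, and both `λ_c` and `q` are real, then `λ_d` is real
(indeed `λ_d = λ_c / (q (1 − λ_c) + λ_c)`). -/
theorem ccr_im_eq_zero_of_crossRatio {lc ld q : ℂ} (hq : q = lc * (1 - ld) / (ld * (1 - lc)))
    (hlc0 : lc ≠ 0) (hlc1 : 1 - lc ≠ 0) (hld0 : ld ≠ 0) (hlc : lc.im = 0) (hqim : q.im = 0) :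
    ld.im = 0 := by
  have hmul : q * (ld * (1 - lc)) = lc * (1 - ld) := by
    rw [hq]; exact div_mul_cancel₀ _ (mul_ne_zero hld0 hlc1)
  have e : ld * (q * (1 - lc) + lc) = lc := by linear_combination hmul
  have hD : q * (1 - lc) + lc ≠ 0 := by
    intro h0
    exact hlc0 (by rw [← e, h0, mul_zero])
  rw [eq_div_of_mul_eq hD e]
  simp [Complex.div_im, Complex.mul_im, hlc, hqim]

/-- A non-degenerate triangle of `ℂ` has a circumcircle: if `a, b, c` are not collinear there are
`o : ℂ` and `R : ℝ` with `dist a o = dist b o = dist c o = R`. -/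
theorem ccr_exists_circumcircle {a b c : ℂ} (h : ¬ Collinear ℝ ({a, b, c} : Set ℂ)) :
    ∃ (o : ℂ) (R : ℝ), dist a o = R ∧ dist b o = R ∧ dist c o = R := by
  have hind : AffineIndependent ℝ ![a, b, c] := affineIndependent_iff_not_collinear_set.mpr h
  let s : Affine.Simplex ℝ ℂ 2 := ⟨![a, b, c], hind⟩
  exact ⟨s.circumcenter, s.circumradius, s.dist_circumcenter_eq_circumradius 0,
    s.dist_circumcenter_eq_circumradius 1, s.dist_circumcenter_eq_circumradius 2⟩

/-- **Cocircular or collinear iff the cross-ratio is real.**  For four distinct points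
`a, b, c, d : ℂ`, `{a, b, c, d}` is cospherical (concyclic) or collinear iff
`Im ((a − c)(b − d) / ((a − d)(b − c))) = 0`. -/
theorem cocircular_iff_crossRatio_real : ∀ a b c d : ℂ, a ≠ b → a ≠ c → a ≠ d → b ≠ c → b ≠ d → c ≠ d → ((EuclideanGeometry.Cospherical ({a, b, c, d} : Set ℂ) ∨ Collinear ℝ ({a, b, c, d} : Set ℂ)) ↔ ((a - c) * (b - d) / ((a - d) * (b - c))).im = 0) := by
  intro a b c d hab hac had hbc hbd hcd
  have hba : b - a ≠ 0 := sub_ne_zero.mpr hab.symm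
  have h4a : a ∈ ({a, b, c, d} : Set ℂ) := by simp
  have h4b : b ∈ ({a, b, c, d} : Set ℂ) := by simp
  constructor
  · rintro (⟨o, R, hS⟩ | hcol)
    · exact (inCircle_iff_crossRatio_im a b c d o R hab hbc hac (hS a h4a) (hS b h4b)
        (hS c (by simp))).2.mp (hS d (by simp))
    · have h := (ccr_collinear_iff h4a h4b hab).mp hcol
      have hc := h c (by simp)
      have hd := h d (by simp)
      rw [ccr_crossRatio_eq hab]
      simp [Complex.div_im, Complex.mul_im, hc, hd]
  · intro him
    by_cases hcol : Collinear ℝ ({a, b, c} : Set ℂ)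
    · right
      have hc : ((c - a) / (b - a)).im = 0 :=
        (ccr_collinear_iff (S := ({a, b, c} : Set ℂ)) (by simp) (by simp) hab).mp hcol c (by simp)
      have hlc0 : (c - a) / (b - a) ≠ 0 := div_ne_zero (sub_ne_zero.mpr (Ne.symm hac)) hba
      have hld0 : (d - a) / (b - a) ≠ 0 := div_ne_zero (sub_ne_zero.mpr (Ne.symm had)) hba
      have hlc1 : 1 - (c - a) / (b - a) ≠ 0 := by
        rw [one_sub_div hba, sub_sub_sub_cancel_right]
        exact div_ne_zero (sub_ne_zero.mpr hbc) hba
      have hd : ((d - a) / (b - a)).im = 0 :=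
        ccr_im_eq_zero_of_crossRatio (ccr_crossRatio_eq (c := c) (d := d) hab) hlc0 hlc1 hld0 hc
          him
      rw [ccr_collinear_iff h4a h4b hab]
      simp only [Set.forall_mem_insert, Set.mem_singleton_iff, forall_eq]
      exact ⟨by simp, by simp [div_self hba], hc, hd⟩
    · left
      obtain ⟨o, R, ha, hb, hc⟩ := ccr_exists_circumcircle hcol
      have hd : dist d o = R :=
        (inCircle_iff_crossRatio_im a b c d o R hab hbc hac ha hb hc).2.mpr him
      refine ⟨o, R, ?_⟩
      simp only [Set.forall_mem_insert, Set.mem_singleton_iff, forall_eq]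
      exact ⟨ha, hb, hc, hd⟩

end Summit.CriticalPhenomena.CardyFormulaZ2.Cruxes.VoronoiHubFromSmirnov.MoebiusExactDelaunayDilationWard

end
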